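import Literature.NumberTheory.EllipticCurves.KummerSelmerStructure
import Literature.NumberTheory.EllipticCurves.KummerImageIsotropy
import Literature.NumberTheory.GaloisRepresentations.LocalGlobalCohomologyTateProofs
import HarnessLib

/-!
# Transport of the Kummer-image isotropy to the restricted modules `E[m](K̄)|_{Γ_E}`

Topic `NumberTheory/EllipticCurves`; namespace `WeierstrassCurve`. Definitions with bodies and theorems
only: **no named fact is introduced** (D-0026); the isotropy itself enters as the HYPOTHESIS
`kummerClass_cupProduct_kummerClass_eq_zero E` (the tree's named fact of `KummerImageIsotropy.lean`,
Poonen–Rains 2012 Prop. 4.8 / Cor. 4.6), in theorems named `…_of_fact`.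

The named isotropy fact is stated NATIVELY over a perfect field `F`: for a Weierstrass curve `W'`
over `F`, Kummer classes `κ(Q) = [σ ↦ σQ - Q] ∈ H¹(F, W'[m](F̄))` (`kummerClassTorsion`) and an
alternating `Γ_F`-equivariant `μ_m`-valued `e` on `W'[m](F̄)`, `κ(Q₁) ∪ₑ κ(Q₂) = 0`. The global
objects of the Cassels–Tate construction over a number field `K` (Selmer structure, Poitou–Tate local
terms: `KummerSelmerStructure.lean`, `WeilPairingTateDual.lean`) live instead on the RESTRICTED
modules `E[m](K̄)|_{Γ_{K_v}}` (`DiscreteGaloisModule.toLocal` / `GaloisRep.restrictField`), whose local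
Kummer classes are `localKummerClass W m hm Q`, `Q ∈ E(K̄_v)`. This file transports the fact from
the base-changed curve `W⁄E` (`E` any `K`-field of characteristic `0`, e.g. `K_v`) to the
restricted module:

* `baseChange_baseChange_algebraicClosure`, `baseChangeGeomPointsEquiv W E : (W⁄E)(Ē) ≃+ E(K̄_E)`
  (identity on coordinates, tree `Affine.Point.congrEquiv`), `Γ_E`-equivariant
  (`baseChangeGeomPointsEquiv_smul`);
* `torsionTransferEquiv W hm : E[m](K̄) ≃+ (W⁄E)[m](Ē)` (`torsionPointsEquiv` followed by the above),
  equivariant along `Γ_E → Γ_K` (`torsionTransferEquiv_smul`), and its inverse as a morphism of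
  discrete `Γ_E`-modules `torsionTransferInvHom : (W⁄E)[m] ⟶ E[m](K̄)|_{Γ_E}`;
* **`A⁻¹_* κ_{W⁄E}(Q') = κ_E(e Q')`** (`cohomologyMap_torsionTransferInvHom_kummerClassTorsion`);
* `muTransferInvHom K m : μ_m(Ē) ⟶ μ_m(K̄)|_{Γ_E}` (inverse of the tree's `muTransferEquiv`);
* the transported pairing `weilPairingTransfer` `e'(S, T) = ι(e(A⁻¹S, A⁻¹T))` on `(W⁄E)[m](Ē)` with
  its biadditivity / `μ_m`-valuedness / alternation / `Γ_E`-equivariance, and the compatibility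
  `ι⁻¹⟨S, T⟩_{e'} = ⟨A⁻¹S, A⁻¹T⟩ₑ` (`muTransferInvHom_weilPairingHom_transfer`);
* **`cupProduct_localKummerClass_eq_zero_of_fact`**: given the fact over `E`,
  `κ_E(Q₁) ∪ₑ κ_E(Q₂) = 0` in `H²(Γ_E, μ_m(K̄))` for the restriction of `weilContPairing W m e …` to
  `Γ_E` (by `ContPairing.cupProduct_map` along `A⁻¹, A⁻¹, ι⁻¹`); hence the local Kummer condition
  `kummerLocalConditionAt W m E` is isotropic (`cupProduct_eq_zero_of_mem_kummerLocalConditionAt_of_fact`)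
  and, over a number field, so is the local condition `W.kummerSelmerStructure m v` at every place
  `v` (`cupProduct_eq_zero_of_mem_kummerSelmerStructure_of_fact`; `charZero_placeCompletion`).

This is the local input "`⟨c_v, b'_v⟩_v = 0` on `im E(K_v) × im E(K_v)`" of the well-definedness of
the Cassels–Tate pairing (Milne, *ADT*, I, proof of Prop. 6.9, and Lemma 6.15), for the provefact
unit `WeierstrassCurve.exists_casselsTate_pairing`.

## References

* [PoonenRains2012] B. Poonen, E. Rains, *Random maximal isotropic subspaces and Selmer groups*,
  J. Amer. Math. Soc. 25 (2012), Prop. 4.8, Cor. 4.6.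
* [MilneADT2006] J. S. Milne, *Arithmetic Duality Theorems*, 2nd ed. (2006), Ch. I §6, proof of
  Prop. 6.9, Lemma 6.15.
* [SilvermanAEC2009] J. H. Silverman, *The Arithmetic of Elliptic Curves*, 2nd ed. (2009), III.§8
  (Weil pairing and base extension), X.§4.
-/

noncomputable section

open scoped Classical

universe u

namespace WeierstrassCurve

open CategoryTheory Literature.NumberTheory.EllipticCurves Literature.NumberTheory.GaloisRepresentations
  Field
open Literature.NumberTheory.GaloisRepresentations.DiscreteGaloisModule (mu MuCarrier)
open scoped ContRepresentation

-- Cup products need `LocallyCompactSpace Γ`; as in the tree's cup-product files, the compactness of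
-- absolute Galois groups is a local instance only.
attribute [local instance] absoluteGaloisGroup_compactSpace

variable {K : Type u} [Field K] (W : WeierstrassCurve K)
variable (E : Type u) [Field E] [Algebra K E]

/-! ## `(E ×_K E')(Ē') = E(Ē')`: the geometric points of the base change -/

/-- The double base change `(W⁄E)⁄Ē` is `W⁄Ē` (`Ē = AlgebraicClosure E` with its `K`-algebra
structure through `E`; Mathlib `WeierstrassCurve.map_map` and `IsScalarTower.algebraMap_eq`).
A private copy of the tree's `Literature.NumberTheory.EllipticCurves.baseChange_baseChange_algebraicClosure`
(file `PeriodIndexObstructionBaseChange`, whose function-field imports are not wanted here). [folklore] -/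
private theorem baseChange_baseChange_algebraicClosure :
    (W.baseChange E).baseChange (AlgebraicClosure E) = W.baseChange (AlgebraicClosure E) := by
  change (W.map (algebraMap K E)).map (algebraMap E (AlgebraicClosure E)) =
    W.map (algebraMap K (AlgebraicClosure E))
  rw [WeierstrassCurve.map_map, ← IsScalarTower.algebraMap_eq]

/-- **`(W⁄E)(Ē) ≃+ E(K̄_E)`**: the geometric points of the base-changed curve `W⁄E` are the local
points `localPoints W E` of `W` (identity on coordinates, across
`baseChange_baseChange_algebraicClosure`; tree `Affine.Point.congrEquiv`). [folklore] -/
def baseChangeGeomPointsEquiv : geomPoints (W.baseChange E) ≃+ localPoints W E :=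
  WeierstrassCurve.Affine.Point.congrEquiv (W.baseChange_baseChange_algebraicClosure E)

/-- `baseChangeGeomPointsEquiv` on an affine point: the same coordinates. [folklore] -/
theorem baseChangeGeomPointsEquiv_some {x y : AlgebraicClosure E}
    (h : ((W.baseChange E).baseChange (AlgebraicClosure E)).toAffine.Nonsingular x y) :
    W.baseChangeGeomPointsEquiv E (show geomPoints (W.baseChange E) from .some x y h) =
      (show localPoints W E from
        .some x y (W.baseChange_baseChange_algebraicClosure E ▸ h)) :=
  WeierstrassCurve.Affine.Point.congrEquiv_some _ h

/-- **`baseChangeGeomPointsEquiv` is `Γ_E`-equivariant** (both actions are coordinatewise).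
[folklore] -/
theorem baseChangeGeomPointsEquiv_smul (σ : absoluteGaloisGroup E) (P : geomPoints (W.baseChange E)) :
    W.baseChangeGeomPointsEquiv E (σ • P) = σ • W.baseChangeGeomPointsEquiv E P := by
  cases P with
  | zero =>
    change W.baseChangeGeomPointsEquiv E (σ • (0 : geomPoints (W.baseChange E))) =
      σ • W.baseChangeGeomPointsEquiv E (0 : geomPoints (W.baseChange E))
    rw [smul_zero, map_zero, smul_zero]
  | @some x y h =>
    rw [baseChangeGeomPointsEquiv_some, localPoints.smul_def, WeierstrassCurve.Affine.Point.map_some]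
    change W.baseChangeGeomPointsEquiv E (WeierstrassCurve.Affine.Point.map _ (.some x y h)) = _
    rw [WeierstrassCurve.Affine.Point.map_some, baseChangeGeomPointsEquiv_some]
    rfl

/-- `baseChangeGeomPointsEquiv⁻¹` is `Γ_E`-equivariant. [folklore] -/
theorem baseChangeGeomPointsEquiv_symm_smul (σ : absoluteGaloisGroup E) (Q : localPoints W E) :
    (W.baseChangeGeomPointsEquiv E).symm (σ • Q) = σ • (W.baseChangeGeomPointsEquiv E).symm Q := by
  apply (W.baseChangeGeomPointsEquiv E).injective
  rw [AddEquiv.apply_symm_apply, baseChangeGeomPointsEquiv_smul, AddEquiv.apply_symm_apply]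

/-! ## Torsion: `E[n](K̄) ≃ (W⁄E)[n](Ē)`, `Γ_E`-equivariantly -/

/-- An additive isomorphism restricts to the `n`-torsion subgroups. [folklore] -/
def _root_.Literature.NumberTheory.EllipticCurves.torsionByCongr {A B : Type*} [AddCommGroup A]
    [AddCommGroup B] (e : A ≃+ B) (n : ℤ) :
    AddSubgroup.torsionBy A n ≃+ AddSubgroup.torsionBy B n where
  toFun T := ⟨e (T : A), by
    rw [AddSubgroup.torsionBy, Submodule.mem_toAddSubgroup, Submodule.mem_torsionBy_iff]
    change n • e (T : A) = 0
    rw [← map_zsmul, show n • (T : A) = 0 from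
      (Submodule.mem_torsionBy_iff _ _).mp T.2, map_zero]⟩
  invFun S := ⟨e.symm (S : B), by
    rw [AddSubgroup.torsionBy, Submodule.mem_toAddSubgroup, Submodule.mem_torsionBy_iff]
    change n • e.symm (S : B) = 0
    rw [← map_zsmul, show n • (S : B) = 0 from
      (Submodule.mem_torsionBy_iff _ _).mp S.2, map_zero]⟩
  left_inv T := Subtype.ext (e.symm_apply_apply (T : A))
  right_inv S := Subtype.ext (e.apply_symm_apply (S : B))
  map_add' T T' := Subtype.ext (map_add e (T : A) (T' : A))

/-- Unfolding `torsionByCongr` on underlying elements. [folklore] -/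
@[simp]
theorem _root_.Literature.NumberTheory.EllipticCurves.coe_torsionByCongr_apply {A B : Type*}
    [AddCommGroup A] [AddCommGroup B] (e : A ≃+ B) (n : ℤ) (T : AddSubgroup.torsionBy A n) :
    ((torsionByCongr e n T : AddSubgroup.torsionBy B n) : B) = e T :=
  rfl

/-- Unfolding `(torsionByCongr e n)⁻¹` on underlying elements. [folklore] -/
@[simp]
theorem _root_.Literature.NumberTheory.EllipticCurves.coe_torsionByCongr_symm_apply {A B : Type*}
    [AddCommGroup A] [AddCommGroup B] (e : A ≃+ B) (n : ℤ) (S : AddSubgroup.torsionBy B n) :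
    (((torsionByCongr e n).symm S : AddSubgroup.torsionBy A n) : A) = e.symm S :=
  rfl

variable {E} [CharZero K] [W.IsElliptic] {n : ℤ} (hn : n ≠ 0)

/-- **`E[n](K̄) ≃+ (W⁄E)[n](Ē)`**: the torsion comparison `torsionPointsEquiv` (along the chosen
`K̄ → Ē`) followed by the identification of `E(K̄_E)` with the geometric points of `W⁄E`.
[folklore] -/
def torsionTransferEquiv : geomTorsion W n ≃+ geomTorsion (W.baseChange E) n :=
  (W.torsionPointsEquiv n (E := E) hn).trans (torsionByCongr (W.baseChangeGeomPointsEquiv E).symm n)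

/-- The underlying point of `torsionTransferEquiv T` is `e⁻¹ (pointsMap T)`. [folklore] -/
theorem coe_torsionTransferEquiv_apply (T : geomTorsion W n) :
    ((W.torsionTransferEquiv (E := E) hn T : geomTorsion (W.baseChange E) n) :
        geomPoints (W.baseChange E)) =
      (W.baseChangeGeomPointsEquiv E).symm (pointsMap W E T) :=
  rfl

/-- The underlying point of `torsionTransferEquiv⁻¹ S` maps to `e S` under `pointsMap`. [folklore] -/
theorem pointsMap_torsionTransferEquiv_symm (S : geomTorsion (W.baseChange E) n) :
    pointsMap W E ((W.torsionTransferEquiv (E := E) hn).symm S : geomTorsion W n) =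
      W.baseChangeGeomPointsEquiv E S := by
  have h := W.coe_torsionTransferEquiv_apply (E := E) hn ((W.torsionTransferEquiv (E := E) hn).symm S)
  rw [AddEquiv.apply_symm_apply] at h
  rw [← (W.baseChangeGeomPointsEquiv E).apply_symm_apply
    (pointsMap W E ((W.torsionTransferEquiv (E := E) hn).symm S : geomTorsion W n)), ← h]

/-- **`torsionTransferEquiv` is `Γ_E`-equivariant** (`Γ_E` acting on `E[n](K̄)` through
`absGaloisRestrict K E`). [folklore] -/
theorem torsionTransferEquiv_smul (σ : absoluteGaloisGroup E) (T : geomTorsion W n) :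
    W.torsionTransferEquiv (E := E) hn (absGaloisRestrict K E σ • T) =
      σ • W.torsionTransferEquiv (E := E) hn T := by
  apply Subtype.ext
  rw [AddSubgroup.torsionBy.coe_smul, coe_torsionTransferEquiv_apply, coe_torsionTransferEquiv_apply,
    ← baseChangeGeomPointsEquiv_symm_smul, ← pointsMap_smul, AddSubgroup.torsionBy.coe_smul,
    resGal_eq_absGaloisRestrict]

/-- Equivariance of `torsionTransferEquiv⁻¹`. [folklore] -/
theorem torsionTransferEquiv_symm_smul (σ : absoluteGaloisGroup E) (S : geomTorsion (W.baseChange E) n) :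
    (W.torsionTransferEquiv (E := E) hn).symm (σ • S) =
      absGaloisRestrict K E σ • (W.torsionTransferEquiv (E := E) hn).symm S := by
  apply (W.torsionTransferEquiv (E := E) hn).injective
  rw [AddEquiv.apply_symm_apply, torsionTransferEquiv_smul, AddEquiv.apply_symm_apply]

/-- **`(W⁄E)[n](Ē) → E[n](K̄)|_{Γ_E}` as a morphism of discrete `Γ_E`-modules** (the inverse torsion
transfer, between `(W.baseChange E).torsionGaloisModule n` and the restriction
`GaloisRep.restrictField E (W.torsionGaloisModule n)`). [folklore] -/
def torsionTransferInvHom :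
    ((W.baseChange E).torsionGaloisModule n).toTopRep ⟶
      DiscreteGaloisModule.toTopRep (GaloisRep.restrictField E (W.torsionGaloisModule n)) :=
  TopRep.ofHom ⟨⟨(W.torsionTransferEquiv (E := E) hn).symm.toIntLinearEquiv.toLinearMap,
      continuous_of_discreteTopology⟩, fun σ => ContinuousLinearMap.ext fun S =>
    W.torsionTransferEquiv_symm_smul (E := E) hn σ S⟩

/-- Unfolding `torsionTransferInvHom`. [folklore] -/
@[simp]
theorem torsionTransferInvHom_apply (S : geomTorsion (W.baseChange E) n) :
    (W.torsionTransferInvHom (E := E) hn).hom S = (W.torsionTransferEquiv (E := E) hn).symm S :=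
  rfl

/-! ## Kummer classes: `A⁻¹_* κ_{W⁄E}(Q') = κ_E(e Q')` -/

omit [CharZero K] [W.IsElliptic] in
/-- If `n • Q'` is `Γ_E`-fixed in `(W⁄E)(Ē)` then `n • e Q'` is `Γ_E`-fixed in `E(K̄_E)`. [folklore] -/
theorem zsmul_baseChangeGeomPointsEquiv_mem_fixedPoints {Q' : geomPoints (W.baseChange E)}
    (hQ' : n • Q' ∈ MulAction.fixedPoints (absoluteGaloisGroup E) (geomPoints (W.baseChange E))) :
    n • W.baseChangeGeomPointsEquiv E Q' ∈
      MulAction.fixedPoints (absoluteGaloisGroup E) (localPoints W E) := fun σ => by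
  rw [← map_zsmul, ← baseChangeGeomPointsEquiv_smul, hQ' σ]

/-- **Transport of Kummer classes**: the inverse torsion transfer takes the Kummer class
`κ_{W⁄E}(Q') = [σ ↦ σQ' - Q'] ∈ H¹(E, (W⁄E)[n])` of the base-changed curve (tree `kummerClassTorsion`)
to the local Kummer class `κ_E(e Q') ∈ H¹(Γ_E, E[n](K̄))` of `KummerSelmerStructure.lean`
(`localKummerClass`). [folklore] -/
theorem cohomologyMap_torsionTransferInvHom_kummerClassTorsion (Q' : geomPoints (W.baseChange E))
    (hQ' : n • Q' ∈ MulAction.fixedPoints (absoluteGaloisGroup E) (geomPoints (W.baseChange E))) :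
    cohomologyMap (W.torsionTransferInvHom (E := E) hn) 1 (kummerClassTorsion (W.baseChange E) n Q' hQ') =
      W.localKummerClass n hn (W.baseChangeGeomPointsEquiv E Q')
        (W.zsmul_baseChangeGeomPointsEquiv_mem_fixedPoints (E := E) hQ') := by
  change cohomologyMap (W.torsionTransferInvHom (E := E) hn) 1
      (oneCocycleClass ((W.baseChange E).torsionGaloisModule n).toTopRep
        (kummerCocycleTorsion (W.baseChange E) n Q' hQ')) =
    oneCocycleClass _ (W.localKummerCocycle n hn _ _)
  rw [cohomologyMap_oneCocycleClass]
  refine congrArg _ (Subtype.ext (ContinuousMap.ext fun σ => ?_))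
  rw [pullback_id_resIdHom_apply]
  apply Subtype.ext
  apply pointsMapOfEmb_injective W (closureEmb (K := K) E)
  change pointsMap W E ((W.torsionTransferEquiv (E := E) hn).symm
      ((kummerCocycleTorsion (W.baseChange E) n Q' hQ').1 σ) : geomTorsion W n) =
    pointsMap W E ((W.localKummerCocycle n hn _ _).1 σ : geomTorsion W n)
  rw [pointsMap_torsionTransferEquiv_symm, pointsMap_localKummerCocycle_apply,
    coe_kummerCocycleTorsion_apply, map_sub, baseChangeGeomPointsEquiv_smul]

/-! ## Roots of unity: `μ_m(Ē) → μ_m(K̄)|_{Γ_E}` -/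

section Mu

variable (K) (m : ℕ) [NeZero m] [CharZero E]

/-- **`μ_m(Ē) → μ_m(K̄)|_{Γ_E}` as a morphism of discrete `Γ_E`-modules**: the inverse of the tree's
transfer `muTransferEquiv K E m` along the chosen embedding `K̄ → Ē` (equivariant by
`muTransfer_mu`). [folklore] -/
def muTransferInvHom :
    (mu E m).toTopRep ⟶
      DiscreteGaloisModule.toTopRep (GaloisRep.restrictField E (mu K m)) :=
  TopRep.ofHom ⟨⟨(muTransferEquiv K E m).symm.toIntLinearEquiv.toLinearMap,
      continuous_of_discreteTopology⟩, fun σ => ContinuousLinearMap.ext fun x => by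
    apply (muTransferEquiv K E m).injective
    change muTransferEquiv K E m ((muTransferEquiv K E m).symm (mu E m σ x)) =
      muTransfer K E m (mu K m (absGaloisRestrict K E σ)
        ((muTransferEquiv K E m).symm x))
    rw [AddEquiv.apply_symm_apply, muTransfer_mu, ← muTransferEquiv_apply, AddEquiv.apply_symm_apply]⟩

/-- Unfolding `muTransferInvHom`. [folklore] -/
@[simp]
theorem muTransferInvHom_apply (x : MuCarrier E m) :
    (muTransferInvHom K (E := E) m).hom x = (muTransferEquiv K E m).symm x :=
  rfl

end Mu

/-! ## The transported Weil pairing on `(W⁄E)[m](Ē)` and the isotropy of the local Kummer image -/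

section Isotropy

variable (m : ℕ) [NeZero m] [CharZero E] (hm : (m : ℤ) ≠ 0)
variable (e : geomTorsion W m → geomTorsion W m → AlgebraicClosure K)

/-- **The transported pairing** `e'(S, T) := ι(e(A⁻¹ S, A⁻¹ T))` on `(W⁄E)[m](Ē)`, with values in
`Ē` (`ι : K̄ → Ē` the chosen embedding, `A = torsionTransferEquiv`): the Weil pairing of `W⁄E`
deduced from a Weil pairing of `W` (Silverman, *AEC*, III.8.1: the Weil pairing is compatible with
base extension). [folklore] -/
def weilPairingTransfer (S T : geomTorsion (W.baseChange E) m) : AlgebraicClosure E :=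
  absClosureEmbedding K E
    (e ((W.torsionTransferEquiv (E := E) hm).symm S) ((W.torsionTransferEquiv (E := E) hm).symm T))

omit [NeZero m] [CharZero E] in
/-- `e'` is `μ_m`-valued. [folklore] -/
theorem weilPairingTransfer_pow (hμ : ∀ S T, e S T ^ m = 1) (S T : geomTorsion (W.baseChange E) m) :
    W.weilPairingTransfer m hm e S T ^ m = 1 := by
  rw [weilPairingTransfer, ← map_pow, hμ, map_one]

omit [NeZero m] [CharZero E] in
/-- `e'` is additive in the first variable. [folklore] -/
theorem weilPairingTransfer_add_left (hadd₁ : ∀ S₁ S₂ T, e (S₁ + S₂) T = e S₁ T * e S₂ T)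
    (S₁ S₂ T : geomTorsion (W.baseChange E) m) :
    W.weilPairingTransfer m hm e (S₁ + S₂) T =
      W.weilPairingTransfer m hm e S₁ T * W.weilPairingTransfer m hm e S₂ T := by
  rw [weilPairingTransfer, weilPairingTransfer, weilPairingTransfer, map_add, hadd₁, map_mul]

omit [NeZero m] [CharZero E] in
/-- `e'` is additive in the second variable. [folklore] -/
theorem weilPairingTransfer_add_right (hadd₂ : ∀ S T₁ T₂, e S (T₁ + T₂) = e S T₁ * e S T₂)
    (S T₁ T₂ : geomTorsion (W.baseChange E) m) :
    W.weilPairingTransfer m hm e S (T₁ + T₂) =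
      W.weilPairingTransfer m hm e S T₁ * W.weilPairingTransfer m hm e S T₂ := by
  rw [weilPairingTransfer, weilPairingTransfer, weilPairingTransfer, map_add, hadd₂, map_mul]

omit [NeZero m] [CharZero E] in
/-- `e'` is alternating if `e` is. [folklore] -/
theorem weilPairingTransfer_self (halt : ∀ T, e T T = 1) (T : geomTorsion (W.baseChange E) m) :
    W.weilPairingTransfer m hm e T T = 1 := by
  rw [weilPairingTransfer, halt, map_one]

omit [NeZero m] [CharZero E] in
/-- `e'` is `Γ_E`-equivariant (from the `Γ_K`-equivariance of `e`, the equivariance of `A⁻¹` and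
`ι(res σ • x) = σ • ι x`). [folklore] -/
theorem weilPairingTransfer_smul
    (hgal : ∀ (σ : absoluteGaloisGroup K) (S T : geomTorsion W m), σ • e S T = e (σ • S) (σ • T))
    (σ : absoluteGaloisGroup E) (S T : geomTorsion (W.baseChange E) m) :
    σ • W.weilPairingTransfer m hm e S T = W.weilPairingTransfer m hm e (σ • S) (σ • T) := by
  rw [weilPairingTransfer, weilPairingTransfer, ← absGaloisRestrict_apply_smul, hgal,
    torsionTransferEquiv_symm_smul, torsionTransferEquiv_symm_smul]

/-- Compatibility of the pairings with the inverse transfers: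
`ι⁻¹ ⟨S, T⟩_{e'} = ⟨A⁻¹ S, A⁻¹ T⟩ₑ` in `μ_m(K̄)` (the hypothesis `hc` of `ContPairing.cupProduct_map`).
[folklore] -/
theorem muTransferInvHom_weilPairingHom_transfer (hμ : ∀ S T, e S T ^ m = 1)
    (hadd₁ : ∀ S₁ S₂ T, e (S₁ + S₂) T = e S₁ T * e S₂ T)
    (hadd₂ : ∀ S T₁ T₂, e S (T₁ + T₂) = e S T₁ * e S T₂) (S T : geomTorsion (W.baseChange E) m) :
    (muTransferInvHom K (E := E) m).hom
        (weilPairingHom (W.baseChange E) m (W.weilPairingTransfer m hm e)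
          (W.weilPairingTransfer_pow m hm e hμ) (W.weilPairingTransfer_add_left m hm e hadd₁)
          (W.weilPairingTransfer_add_right m hm e hadd₂) S T) =
      weilPairingHom W m e hμ hadd₁ hadd₂ ((W.torsionTransferEquiv (E := E) hm).symm S)
        ((W.torsionTransferEquiv (E := E) hm).symm T) := by
  rw [muTransferInvHom_apply, AddEquiv.symm_apply_eq]
  apply muVal_injective E m
  apply Units.ext
  rfl

/-- **Isotropy of the local Kummer image for the restricted Weil cup product.** Assume the named
fact `kummerClass_cupProduct_kummerClass_eq_zero E` (Poonen–Rains 2012, Prop. 4.8 / Cor. 4.6: the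
Kummer image is isotropic for `∪ₑ`, over the perfect field `E`). Then for the local Kummer classes
`κ_E(Q₁), κ_E(Q₂) ∈ H¹(Γ_E, E[m](K̄))` (`localKummerClass`, the elements of the local Kummer condition
`kummerLocalConditionAt W m E`) and any alternating biadditive `Γ_K`-equivariant `μ_m`-valued `e` on
`E[m](K̄)`,

  `κ_E(Q₁) ∪ₑ κ_E(Q₂) = 0` in `H²(Γ_E, μ_m(K̄))`,

the cup product being that of the restriction `(weilContPairing W m e …).restrict (Γ_E → Γ_K)`
(definitionally the local Weil pairing `weilContPairingLocal` at a place). Proof: transport the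
fact for the base-changed curve `W⁄E` and the transported pairing `e'` along the inverse transfers
`A⁻¹ : (W⁄E)[m] → E[m](K̄)|_{Γ_E}`, `ι⁻¹ : μ_m(Ē) → μ_m(K̄)|_{Γ_E}` (`ContPairing.cupProduct_map`,
`cohomologyMap_torsionTransferInvHom_kummerClassTorsion`). This is the local input
"`⟨c_v, b'_v⟩ = 0` for `c_v, b'_v` in the image of `A(K_v)`" of the well-definedness of the
Cassels–Tate pairing (Milne, *ADT*, I, proof of Prop. 6.9 and Lemma 6.15).
[cite: PoonenRains2012, Prop. 4.8 and Cor. 4.6] [cite: MilneADT2006, Ch. I §6, proof of Prop. 6.9] -/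
theorem cupProduct_localKummerClass_eq_zero_of_fact
    (hiso : kummerClass_cupProduct_kummerClass_eq_zero E) (hμ : ∀ S T, e S T ^ m = 1)
    (hadd₁ : ∀ S₁ S₂ T, e (S₁ + S₂) T = e S₁ T * e S₂ T)
    (hadd₂ : ∀ S T₁ T₂, e S (T₁ + T₂) = e S T₁ * e S T₂) (halt : ∀ T, e T T = 1)
    (hgal : ∀ (σ : absoluteGaloisGroup K) (S T : geomTorsion W m), σ • e S T = e (σ • S) (σ • T))
    (Q₁ Q₂ : localPoints W E)
    (hQ₁ : (m : ℤ) • Q₁ ∈ MulAction.fixedPoints (absoluteGaloisGroup E) (localPoints W E))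
    (hQ₂ : (m : ℤ) • Q₂ ∈ MulAction.fixedPoints (absoluteGaloisGroup E) (localPoints W E)) :
    ((weilContPairing W m e hμ hadd₁ hadd₂ hgal).restrict (absGaloisRestrict K E)).cupProduct
      (W.localKummerClass m hm Q₁ hQ₁) (W.localKummerClass m hm Q₂ hQ₂) = 0 := by
  -- `[m]` acts on the source curve `W⁄E` over the perfect field `E`
  have hmE : (m : E) ≠ 0 := Nat.cast_ne_zero.mpr (NeZero.ne m)
  -- the points of `W⁄E` under the local points `Qᵢ`
  set eE := W.baseChangeGeomPointsEquiv E with heE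
  have hfix : ∀ {Q : localPoints W E},
      (m : ℤ) • Q ∈ MulAction.fixedPoints (absoluteGaloisGroup E) (localPoints W E) →
      (m : ℤ) • eE.symm Q ∈
        MulAction.fixedPoints (absoluteGaloisGroup E) (geomPoints (W.baseChange E)) :=
    fun {Q} hQ σ => by
      rw [← map_zsmul, ← baseChangeGeomPointsEquiv_symm_smul, hQ σ]
  have hκ : ∀ (Q : localPoints W E)
      (hQ : (m : ℤ) • Q ∈ MulAction.fixedPoints (absoluteGaloisGroup E) (localPoints W E)),
      W.localKummerClass m hm Q hQ = cohomologyMap (W.torsionTransferInvHom (E := E) hm) 1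
        (kummerClassTorsion (W.baseChange E) m (eE.symm Q) (hfix hQ)) := fun Q hQ => by
    rw [cohomologyMap_torsionTransferInvHom_kummerClassTorsion]
    exact localKummerClass_congr (eE.apply_symm_apply Q).symm
  have hcup := ContPairing.cupProduct_map
    (weilContPairing (W.baseChange E) m (W.weilPairingTransfer m hm e)
      (W.weilPairingTransfer_pow m hm e hμ) (W.weilPairingTransfer_add_left m hm e hadd₁)
      (W.weilPairingTransfer_add_right m hm e hadd₂) (W.weilPairingTransfer_smul m hm e hgal))
    ((weilContPairing W m e hμ hadd₁ hadd₂ hgal).restrict (absGaloisRestrict K E))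
    (W.torsionTransferInvHom (E := E) hm) (W.torsionTransferInvHom (E := E) hm)
    (muTransferInvHom K (E := E) m)
    (fun S T => W.muTransferInvHom_weilPairingHom_transfer m hm e hμ hadd₁ hadd₂ S T)
    (kummerClassTorsion (W.baseChange E) m (eE.symm Q₁) (hfix hQ₁))
    (kummerClassTorsion (W.baseChange E) m (eE.symm Q₂) (hfix hQ₂))
  have h0 := hiso (W.baseChange E) m hmE (W.weilPairingTransfer m hm e)
    (W.weilPairingTransfer_pow m hm e hμ) (W.weilPairingTransfer_add_left m hm e hadd₁)
    (W.weilPairingTransfer_add_right m hm e hadd₂) (W.weilPairingTransfer_self m hm e halt)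
    (W.weilPairingTransfer_smul m hm e hgal) (eE.symm Q₁) (eE.symm Q₂) (hfix hQ₁) (hfix hQ₂)
  rw [h0, map_zero] at hcup
  rw [hκ Q₁ hQ₁, hκ Q₂ hQ₂]
  exact hcup.symm

/-- **The local Kummer condition is isotropic** (given the named isotropy fact over `E`): for
`c₁, c₂ ∈ 𝓛_E = ker (H¹(Γ_E, E[m](K̄)) → H¹(Γ_E, E(K̄_E)))` (`kummerLocalConditionAt W m E`),
`c₁ ∪ₑ c₂ = 0` in `H²(Γ_E, μ_m(K̄))`. [cite: PoonenRains2012, Prop. 4.8 and Cor. 4.6]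
[cite: MilneADT2006, Ch. I §6, proof of Prop. 6.9] -/
theorem cupProduct_eq_zero_of_mem_kummerLocalConditionAt_of_fact (hm : (m : ℤ) ≠ 0)
    (hiso : kummerClass_cupProduct_kummerClass_eq_zero E) (hμ : ∀ S T, e S T ^ m = 1)
    (hadd₁ : ∀ S₁ S₂ T, e (S₁ + S₂) T = e S₁ T * e S₂ T)
    (hadd₂ : ∀ S T₁ T₂, e S (T₁ + T₂) = e S T₁ * e S T₂) (halt : ∀ T, e T T = 1)
    (hgal : ∀ (σ : absoluteGaloisGroup K) (S T : geomTorsion W m), σ • e S T = e (σ • S) (σ • T))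
    {c₁ c₂ : galoisCohomology (GaloisRep.restrictField E (W.torsionGaloisModule m)) 1}
    (hc₁ : c₁ ∈ W.kummerLocalConditionAt m E) (hc₂ : c₂ ∈ W.kummerLocalConditionAt m E) :
    ((weilContPairing W m e hμ hadd₁ hadd₂ hgal).restrict (absGaloisRestrict K E)).cupProduct
      c₁ c₂ = 0 := by
  obtain ⟨Q₁, hQ₁, rfl⟩ := W.exists_eq_localKummerClass_of_mem m hm hc₁
  obtain ⟨Q₂, hQ₂, rfl⟩ := W.exists_eq_localKummerClass_of_mem m hm hc₂
  exact W.cupProduct_localKummerClass_eq_zero_of_fact m hm e hiso hμ hadd₁ hadd₂ halt hgal Q₁ Q₂ hQ₁ hQ₂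

end Isotropy

/-! ## Over a number field: isotropy of the local conditions of the Kummer Selmer structure -/

section NumberField

open NumberField

omit [CharZero K] [W.IsElliptic] in
/-- The completion of a number field at a place has characteristic `0` (it is a `K`-algebra and a
field). [folklore] -/
theorem _root_.Literature.NumberTheory.EllipticCurves.charZero_placeCompletion [NumberField K]
    (v : Place K) : CharZero (Place.Completion v) :=
  charZero_of_injective_algebraMap (algebraMap K (Place.Completion v)).injective

variable [NumberField K] (m : ℕ) [NeZero m]
variable (e : geomTorsion W m → geomTorsion W m → AlgebraicClosure K)

/-- **Isotropy of the local condition `𝓛_v` of the Kummer Selmer structure at every place `v`**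
(finite or infinite), for the local Weil cup product `H¹(K_v, E[m]) × H¹(K_v, E[m]) → H²(K_v, μ_m)`
(the restriction of `weilContPairing` to `Γ_{K_v}`, i.e. `weilContPairingLocal` of
`WeilPairingTateDual.lean`), GIVEN the named isotropy fact over the completion `K_v`:
`x ∪ₑ y = 0` for `x, y ∈ 𝓛_v`. This is the local vanishing `⟨x_v, y_v⟩_v = 0` on
`im (E(K_v)) × im (E(K_v))` entering the well-definedness of the Cassels–Tate pairing
(Milne, *ADT*, I, proof of Prop. 6.9; Lemma 6.15). [cite: MilneADT2006, Ch. I §6, proof of Prop. 6.9]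
[cite: PoonenRains2012, Prop. 4.8 and Cor. 4.6] -/
theorem cupProduct_eq_zero_of_mem_kummerSelmerStructure_of_fact (hm : (m : ℤ) ≠ 0) (v : Place K)
    (hiso : kummerClass_cupProduct_kummerClass_eq_zero (Place.Completion v))
    (hμ : ∀ S T, e S T ^ m = 1)
    (hadd₁ : ∀ S₁ S₂ T, e (S₁ + S₂) T = e S₁ T * e S₂ T)
    (hadd₂ : ∀ S T₁ T₂, e S (T₁ + T₂) = e S T₁ * e S T₂) (halt : ∀ T, e T T = 1)
    (hgal : ∀ (σ : absoluteGaloisGroup K) (S T : geomTorsion W m), σ • e S T = e (σ • S) (σ • T))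
    {x y : galoisCohomology ((W.torsionGaloisModule m).toLocal v) 1}
    (hx : x ∈ W.kummerSelmerStructure m v) (hy : y ∈ W.kummerSelmerStructure m v) :
    ((weilContPairing W m e hμ hadd₁ hadd₂ hgal).restrict
      (absGaloisRestrict K (Place.Completion v))).cupProduct x y = 0 := by
  haveI := charZero_placeCompletion (K := K) v
  exact W.cupProduct_eq_zero_of_mem_kummerLocalConditionAt_of_fact m e hm hiso hμ hadd₁ hadd₂ halt
    hgal hx hy

end NumberField

end WeierstrassCurve
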